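import Summits.BirchSwinnertonDyer.BirchSwinnertonDyer.Theorems.SchneiderFreeAdditiveX3GordCellPerPairOfPT
import Summits.BirchSwinnertonDyer.BirchSwinnertonDyer.Theorems.EisensteinPrimesPoitouTateShaNaturalAtTC
import Summits.BirchSwinnertonDyer.BirchSwinnertonDyer.Theorems.EisensteinPrimesResidualCharacterSelmerFiniteOfFact
import HarnessLib

/-!
# Route `SchneiderFreeAdditiveX3` (K1 door): the PER-PAIR records — lower half, both halves from the twist-unit datum, Miller's `BSD(E, p)` — on the
# WHOLE (G-ord, `e = 2`) half at every odd prime, with generation 40's Milne ADT I Thm. 4.10 (a) binder AND the CGLS Prop. 14 finiteness binder DISCHARGED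
# BY NAME (no Greenberg, no duality binder, no separate finiteness clause)

Cell `bsd-schneider-ideate`, seat `bsd-schneider-door-c5` (prover, generation 41; assembly layer; `--supports` 19177).  PARTITION: board row
B6 ∩ X3 ∩ sst-twist, `r = 1`, the WHOLE (G-ord, `e = 2`) half (2 560 of 7 101 census pairs: 2 411 at `p = 3`, 149 at `p ≥ 5`) of `Rank1Residual.partition`
— ASSEMBLY; types-the-object-of nothing new; RE-KEYS generation 40's F42 `KYBranchPerPairOfPT.*` off its last textbook binder
`hPT : ∀ L [IsTotallyComplex L] S, S.Finite → poitouTate_shaRestricted_tateDual_natural_at L S`, which IS the tree theorem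
`PoitouTateShaNaturalAtTC.forall_poitouTate_shaRestricted_tateDual_natural_at_of_isTotallyComplex` (cell `bsd-eis`, lane «PT-Ш-S-TC», 2026-08-29), and off
its finiteness binder `hfact : prop14_residualCharacterSelmer_finite` (CGLS Prop. 14), derived from the module clause `hprop125` by cell `bsd-eis`'s tree
theorem `TeichmullerPairUnramifiedAtMult.prop14_residualCharacterSelmer_finite_of_fact` (2026-08-28); closes none of B6's cells (BSD NOT advanced).  bears_on: K1-door (19177 r3; per-pair statements of the rung leaf and of `BSDp`).
* §1 `p = 3`: `missingLowerBoundAt_gordTwo_three`, `missingPPartAt_gordTwo_three_of_twistUnitAt`, `bsdp_gordTwo_three_of_twistUnitAt`.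
* §2 `p ≥ 5`: `missingLowerBoundAt_gordTwo_five_le`, `missingPPartAt_gordTwo_five_le_of_twistUnitAt`, `bsdp_gordTwo_five_le_of_twistUnitAt`.
* §3 every odd `p`: `missingLowerBoundAt_gordTwo`, `missingPPartAt_gordTwo_of_twistUnitAt`, `bsdp_gordTwo_of_twistUnitAt`.
INPUT LEDGER per pair (lower half) after this file: `PrintedFacts` ∪ {Hsieh A, LZZ, Castella–Hsieh signed} ∪ {[DIV.dvd] PRE; [AN3] (both forms), [AN-BR₅]
PRE; [BR3]; CGLS Thm 2.1.2} ∪ {CGLS Prop 1.2.5 (module clause), Cor 1.2.6 ×2; [RH], [PWL-θ]; Rubin 4.1; Katz II.6.4; Hida Thm I} — NO Greenberg, NO duality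
binder, NO separate finiteness clause; both halves add the pair's twist-unit datum `Upper.TwistUnitFieldOffSliverAt W p` (census: a kit certificate per pair; class-wide: wing
r2, OPEN).
HONEST FRAMING: compositions of tree theorems, CONDITIONAL BY NAME on the displayed statements; `BSDp W p` here is BSD_p MODULO those statements and the
pair's TU datum — NOT a proof of BSD for any curve; no definition, no named fact, no `sorry`; nothing is closed; «closes rung: none».  References:
[KellerYin2024b] Thm. 3.3.6, Prop. 3.4.4, §3.5, Thm. 3.5.1, Lemma 2.3.8; [KellerYin2024] Thms. 1.2.2, 1.4.1, Prop. 1.2.5; [CastellaGrossiLeeSkinner2022] Thms. 1.2.2,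
2.1.2, 2.2.2, Props. 1.2.5, 14, Cor. 1.2.6; [MilneADT2006] I Thm. 4.10 (a); [Miller2011LMS] Def. 1.1; [JetchevSkinnerWan2017] §7.4.1; [FriedbergHoffstein1995] Thm. B;
[GrossZagier1986] I.(6.3), (7.3); this seat p732334 (F20), p758065 (F42).
-/

set_option autoImplicit false
set_option linter.dupNamespace false -- the summit namespace `…BirchSwinnertonDyer.BirchSwinnertonDyer.Theorems` (Sub = Summit, D-0017) trips it

noncomputable section

open scoped Classical NumberField

open Field NumberField IsDedekindDomain WeierstrassCurve PowerSeries
  Literature.NumberTheory.EllipticCurves Literature.NumberTheory.EllipticCurves.GreenbergSelmer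
  Literature.NumberTheory.GaloisRepresentations Literature.NumberTheory.GaloisCohomology
  Literature.NumberTheory.EllipticCurves.ModularForms Literature.NumberTheory.EllipticCurves.Rank1Residual
  Literature.NumberTheory.EllipticCurves.Rank1Residual.Typed
  Literature.NumberTheory.EllipticCurves.KellerYin2024 Literature.NumberTheory.EllipticCurves.CaiShuTian2014
  Literature.NumberTheory.IwasawaTheory Literature.NumberTheory.IwasawaTheory.Greenberg2016
  Literature.NumberTheory.IwasawaTheory.Greenberg2006
  Literature.NumberTheory.EllipticCurves.Rubin1991 Literature.NumberTheory.EllipticCurves.DeShalit1987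
  Literature.NumberTheory.EllipticCurves.Hida2010MuInvariant Literature.NumberTheory.EllipticCurves.BCGKPST2020
  Summit.BirchSwinnertonDyer.Rank1Residual Summit.BirchSwinnertonDyer.Rank1Residual.X11b
  Summit.BirchSwinnertonDyer.Rank1Residual.X11b.AcSelmer Summit.BirchSwinnertonDyer.Rank1Residual.X11b.Halves
  Summit.BirchSwinnertonDyer.Rank1Residual.Additive Summit.BirchSwinnertonDyer.Rank1Residual.GaloisImage
  Summit.BirchSwinnertonDyer.BirchSwinnertonDyer.Theorems
  Summit.BirchSwinnertonDyer.BirchSwinnertonDyer.Theorems.EisensteinPrimesMuLambda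
  Summit.BirchSwinnertonDyer.BirchSwinnertonDyer.Theorems.SchneiderFree
  Summit.BirchSwinnertonDyer.BirchSwinnertonDyer.Theorems.SchneiderFree.Upper
  Summit.BirchSwinnertonDyer.BirchSwinnertonDyer.Theorems.SchneiderFree.KYRead
  Summit.BirchSwinnertonDyer.BirchSwinnertonDyer.Theses.SchneiderFreeAdditiveX3
  Summit.BirchSwinnertonDyer.BirchSwinnertonDyer.Theorems.SchneiderFreeAdditiveX3
open Literature.NumberTheory.EllipticCurves.CastellaGrossiLeeSkinner2022
  (prop14_residualCharacterSelmer_finite thm212_exists_isKatzLFunction prop125_characterGrSelmerDual_torsion_muZero_dim prop125_characterGrSelmerDual_corank_ge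
    cor126_residualCharacter_globalLift cor126_residualCharacter_localSurjective)
open Literature.NumberTheory.EllipticCurves.KellerYin2024 (thm122_rubinHida_residualPair_unrSelmer prop125_residualPair_unrSelmer_imprimitive
  thm351_anacong_branch_three_allTwists thm351_anacong_charLambda_branch_five_le)
open Summit.BirchSwinnertonDyer.BirchSwinnertonDyer.Theorems.PoitouTateShaNaturalAtTC
  (forall_poitouTate_shaRestricted_tateDual_natural_at_of_isTotallyComplex)
open Summit.BirchSwinnertonDyer.BirchSwinnertonDyer.Theorems.TeichmullerPairUnramifiedAtMult (prop14_residualCharacterSelmer_finite_of_fact)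

namespace Summit.BirchSwinnertonDyer.BirchSwinnertonDyer.Theorems.SchneiderFreeAdditiveX3.KYBranchPerPairOfTree

/-! ### §1 `p = 3`: the per-pair records on the whole (G-ord, `e = 2`) cell — no Greenberg, no duality binder -/

/-- **LOWER half per pair on the WHOLE (G-ord, `e = 2`) cell AT `p = 3`, no per-pair hypothesis, no Greenberg input, no duality binder:** for every globally
minimal `W/ℚ` with `r_an = 1`, `ClassX3 W 3`, `SubGordTwo W 3`: `MissingLowerBoundAt W 3` (`ord₃ #Ш(E)_an ≤ ord₃ #Ш(E)`) — F42's record with its Milne ADT I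
Thm. 4.10 (a) binder fed by the tree theorem `forall_poitouTate_shaRestricted_tateDual_natural_at_of_isTotallyComplex`.  CONDITIONAL on the displayed named
statements; closes no item; BSD not advanced. [claim: KellerYin2024PotOrd, status: under-review]
[cite: KellerYin2024b, Thm. 3.3.6, Prop. 3.4.4, Thm. 3.5.1 (arXiv:2410.23241 pp. 19–20) (preprint; hypotheses)]
[cite: CastellaGrossiLeeSkinner2022, Thms. 1.2.2, 2.1.2, 2.2.2, Props. 1.2.5, 14, Cor. 1.2.6] [cite: KellerYin2024, Thms. 1.2.2, 1.4.1, Prop. 1.2.5 (arXiv:2402.12781v2)]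
[cite: MilneADT2006, I Thm. 4.10 (a)] [cite: JetchevSkinnerWan2017, §7.4.1 (arXiv:1512.06894 p. 30)] -/
theorem missingLowerBoundAt_gordTwo_three (hF : PrintedFacts)
    (hA : Hsieh2014.thmA_exists_isHsiehLFunction_unrPeriod_anyLevel)
    (hL : LiuZhangZhang2018.thm151_thm153_modularCurve_heegnerVector_additive)
    (hCHσ : castellaHsieh2018_exists_isBranchBDPLFunction_signed)
    (hDVD : thm336_dvd_branch_OPEN) (hAN3 : thm351_anacong_branch_three) (hAN : thm351_anacong_branch_three_allTwists)
    (hBR : thm122_charLambda_pair_three) (h212 : thm212_exists_isKatzLFunction)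
    (hprop125 : prop125_characterGrSelmerDual_torsion_muZero_dim)
    (hlift : cor126_residualCharacter_globalLift) (hlocal : cor126_residualCharacter_localSurjective)
    (hRH : thm122_rubinHida_residualPair_unrSelmer) (hPWL : prop125_residualPair_unrSelmer_imprimitive)
    (h331 : thm331_rubin_exists_katzMeasure₂_pseudoIso_span_eq)
    (hFE : thmII64_katzMeasure₂_functionalEquation) (hO1 : thmI_mu_katzBranch_reflect_eq_zero) :
    ∀ (W : WeierstrassCurve ℚ) [W.IsElliptic] [W.IsGloballyMinimal],
      W.analyticRank = 1 → ClassX3 W 3 → Additive.SubGordTwo W 3 → MissingLowerBoundAt W 3 :=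
  KYBranchPerPairOfPT.missingLowerBoundAt_gordTwo_three hF hA hL hCHσ hDVD hAN3 hAN hBR h212 hprop125 (prop14_residualCharacterSelmer_finite_of_fact hprop125) hlift hlocal hRH hPWL h331 hFE hO1
    forall_poitouTate_shaRestricted_tateDual_natural_at_of_isTotallyComplex

/-- **BOTH halves per pair on the whole (G-ord, `e = 2`) cell AT `p = 3` from the TU datum: `MissingPPartAt W 3`, no Greenberg input, no duality binder** — F42's
record with its Milne binder fed by the tree theorem.  CONDITIONAL; closes no item; BSD not advanced. [claim: KellerYin2024PotOrd, status: under-review]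
[cite: Miller2011LMS, Def. 1.1] [cite: KellerYin2024b, Thm. 3.3.6 and Prop. 3.4.4 (arXiv:2410.23241 p. 19) (preprint; hypothesis)]
[cite: CastellaGrossiLeeSkinner2022, Thms. 1.2.2, 2.1.2, 2.2.2, Prop. 14] -/
theorem missingPPartAt_gordTwo_three_of_twistUnitAt (hF : PrintedFacts)
    (hA : Hsieh2014.thmA_exists_isHsiehLFunction_unrPeriod_anyLevel)
    (hL : LiuZhangZhang2018.thm151_thm153_modularCurve_heegnerVector_additive)
    (hCHσ : castellaHsieh2018_exists_isBranchBDPLFunction_signed)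
    (hDVD : thm336_dvd_branch_OPEN) (hAN3 : thm351_anacong_branch_three) (hAN : thm351_anacong_branch_three_allTwists)
    (hBR : thm122_charLambda_pair_three) (h212 : thm212_exists_isKatzLFunction)
    (hprop125 : prop125_characterGrSelmerDual_torsion_muZero_dim)
    (hlift : cor126_residualCharacter_globalLift) (hlocal : cor126_residualCharacter_localSurjective)
    (hRH : thm122_rubinHida_residualPair_unrSelmer) (hPWL : prop125_residualPair_unrSelmer_imprimitive)
    (h331 : thm331_rubin_exists_katzMeasure₂_pseudoIso_span_eq)
    (hFE : thmII64_katzMeasure₂_functionalEquation) (hO1 : thmI_mu_katzBranch_reflect_eq_zero) :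
    ∀ (W : WeierstrassCurve ℚ) [W.IsElliptic] [W.IsGloballyMinimal],
      W.analyticRank = 1 → ClassX3 W 3 → Additive.SubGordTwo W 3 → Upper.TwistUnitFieldOffSliverAt W 3 → MissingPPartAt W 3 :=
  KYBranchPerPairOfPT.missingPPartAt_gordTwo_three_of_twistUnitAt hF hA hL hCHσ hDVD hAN3 hAN hBR h212 hprop125 (prop14_residualCharacterSelmer_finite_of_fact hprop125) hlift hlocal hRH hPWL
    h331 hFE hO1 forall_poitouTate_shaRestricted_tateDual_natural_at_of_isTotallyComplex

/-- **Miller's `BSD(E, 3)` per pair on the WHOLE (G-ord, `e = 2`) cell from the TU datum, no Greenberg input, no duality binder** — F42's record with its Milne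
binder fed by the tree theorem.  NOT a proof of BSD for any curve: BSD₃ MODULO {published theorems} ∪ {[DIV.dvd] (preprint), the analytic counts, [RH], [PWL-θ]}
∪ {the pair's TU certificate}. [claim: KellerYin2024PotOrd, status: under-review] [cite: Miller2011LMS, §1 and Def. 1.1]
[cite: KellerYin2024b, Thm. 3.3.6 and Prop. 3.4.4 (arXiv:2410.23241 p. 19) (preprint; hypothesis)] -/
theorem bsdp_gordTwo_three_of_twistUnitAt (hF : PrintedFacts)
    (hA : Hsieh2014.thmA_exists_isHsiehLFunction_unrPeriod_anyLevel)
    (hL : LiuZhangZhang2018.thm151_thm153_modularCurve_heegnerVector_additive)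
    (hCHσ : castellaHsieh2018_exists_isBranchBDPLFunction_signed)
    (hDVD : thm336_dvd_branch_OPEN) (hAN3 : thm351_anacong_branch_three) (hAN : thm351_anacong_branch_three_allTwists)
    (hBR : thm122_charLambda_pair_three) (h212 : thm212_exists_isKatzLFunction)
    (hprop125 : prop125_characterGrSelmerDual_torsion_muZero_dim)
    (hlift : cor126_residualCharacter_globalLift) (hlocal : cor126_residualCharacter_localSurjective)
    (hRH : thm122_rubinHida_residualPair_unrSelmer) (hPWL : prop125_residualPair_unrSelmer_imprimitive)
    (h331 : thm331_rubin_exists_katzMeasure₂_pseudoIso_span_eq)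
    (hFE : thmII64_katzMeasure₂_functionalEquation) (hO1 : thmI_mu_katzBranch_reflect_eq_zero) :
    ∀ (W : WeierstrassCurve ℚ) [W.IsElliptic] [W.IsGloballyMinimal],
      W.analyticRank = 1 → ClassX3 W 3 → Additive.SubGordTwo W 3 → Upper.TwistUnitFieldOffSliverAt W 3 → BSDp W 3 :=
  KYBranchPerPairOfPT.bsdp_gordTwo_three_of_twistUnitAt hF hA hL hCHσ hDVD hAN3 hAN hBR h212 hprop125 (prop14_residualCharacterSelmer_finite_of_fact hprop125) hlift hlocal hRH hPWL h331 hFE hO1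
    forall_poitouTate_shaRestricted_tateDual_natural_at_of_isTotallyComplex

/-! ### §2 `p ≥ 5`: the per-pair records (no sliver, no Mazur) — no Greenberg, no duality binder -/

/-- **LOWER half per pair on the (G-ord, `e = 2`) cell AT `p ≥ 5` ⇐ `PrintedFacts` ∧ Hsieh A ∧ LZZ ∧ Castella–Hsieh signed ∧ [DIV.dvd] ∧ [AN-BR₅] ∧ CGLS Prop 1.2.5
(module clause), Cor 1.2.6 ×2 — NO crux, NO per-pair hypothesis, NO sliver, NO Greenberg, NO duality binder, NO separate finiteness clause** — F42's record (generation 33's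
per-datum proof) with its Milne binder fed by the tree theorem.  CONDITIONAL; closes no item; BSD not advanced. [claim: KellerYin2024PotOrd, status: under-review]
[cite: KellerYin2024b, Thm. 3.3.6, Prop. 3.4.4, §3.5, Thm. 3.5.1 and Lemma 2.3.8 (arXiv:2410.23241 pp. 11, 19–20) (preprint; hypotheses)]
[cite: CastellaGrossiLeeSkinner2022, Thm. 1.2.2, Props. 1.2.5, 14, Cor. 1.2.6] [cite: MilneADT2006, I Thm. 4.10 (a)] [cite: JetchevSkinnerWan2017, §7.4.1]
[cite: FriedbergHoffstein1995, Thm. B] [cite: GrossZagier1986, Thm. I.(6.3) and (7.3)] -/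
theorem missingLowerBoundAt_gordTwo_five_le (hF : PrintedFacts)
    (hA : Hsieh2014.thmA_exists_isHsiehLFunction_unrPeriod_anyLevel)
    (hL : LiuZhangZhang2018.thm151_thm153_modularCurve_heegnerVector_additive)
    (hCHσ : castellaHsieh2018_exists_isBranchBDPLFunction_signed)
    (hDVD : thm336_dvd_branch_OPEN) (hAN : thm351_anacong_charLambda_branch_five_le)
    (hprop125 : prop125_characterGrSelmerDual_torsion_muZero_dim)
    (hlift : cor126_residualCharacter_globalLift) (hlocal : cor126_residualCharacter_localSurjective) :
    ∀ (W : WeierstrassCurve ℚ) [W.IsElliptic] [W.IsGloballyMinimal] (p : ℕ) [Fact p.Prime],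
      5 ≤ p → W.analyticRank = 1 → ClassX3 W p → Additive.SubGordTwo W p → MissingLowerBoundAt W p :=
  KYBranchPerPairOfPT.missingLowerBoundAt_gordTwo_five_le hF hA hL hCHσ hDVD hAN hprop125 (prop14_residualCharacterSelmer_finite_of_fact hprop125) hlift hlocal
    forall_poitouTate_shaRestricted_tateDual_natural_at_of_isTotallyComplex

/-- **BOTH halves per pair on the (G-ord, `e = 2`) cell AT `p ≥ 5`: `MissingPPartAt W p` ⇐ §2's inputs ∧ the pair's twist-unit datum, no Greenberg input, no duality
binder** — F42's record with its Milne binder fed by the tree theorem.  CONDITIONAL; closes no item; BSD not advanced. [claim: KellerYin2024PotOrd, status: under-review]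
[cite: Miller2011LMS, Def. 1.1] [cite: KellerYin2024b, Thm. 3.3.6, Prop. 3.4.4 and §3.5 (arXiv:2410.23241 pp. 19–20) (preprint; hypotheses)]
[cite: CastellaGrossiLeeSkinner2022, Thm. 1.2.2, Props. 1.2.5, 14, Cor. 1.2.6] -/
theorem missingPPartAt_gordTwo_five_le_of_twistUnitAt (hF : PrintedFacts)
    (hA : Hsieh2014.thmA_exists_isHsiehLFunction_unrPeriod_anyLevel)
    (hL : LiuZhangZhang2018.thm151_thm153_modularCurve_heegnerVector_additive)
    (hCHσ : castellaHsieh2018_exists_isBranchBDPLFunction_signed)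
    (hDVD : thm336_dvd_branch_OPEN) (hAN : thm351_anacong_charLambda_branch_five_le)
    (hprop125 : prop125_characterGrSelmerDual_torsion_muZero_dim)
    (hlift : cor126_residualCharacter_globalLift) (hlocal : cor126_residualCharacter_localSurjective) :
    ∀ (W : WeierstrassCurve ℚ) [W.IsElliptic] [W.IsGloballyMinimal] (p : ℕ) [Fact p.Prime],
      5 ≤ p → W.analyticRank = 1 → ClassX3 W p → Additive.SubGordTwo W p → Upper.TwistUnitFieldOffSliverAt W p → MissingPPartAt W p :=
  KYBranchPerPairOfPT.missingPPartAt_gordTwo_five_le_of_twistUnitAt hF hA hL hCHσ hDVD hAN hprop125 (prop14_residualCharacterSelmer_finite_of_fact hprop125) hlift hlocal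
    forall_poitouTate_shaRestricted_tateDual_natural_at_of_isTotallyComplex

/-- **Miller's `BSD(E, p)` per pair on the (G-ord, `e = 2`) cell AT `p ≥ 5` from the TU datum, no Greenberg input, no duality binder** — F42's record with its Milne
binder fed by the tree theorem.  NOT a proof of BSD for any curve: BSD_p MODULO {published theorems} ∪ {[DIV.dvd], [AN-BR₅] (preprint)} ∪ {the pair's TU
certificate}. [claim: KellerYin2024PotOrd, status: under-review] [cite: Miller2011LMS, §1 and Def. 1.1]
[cite: KellerYin2024b, Thm. 3.3.6, Prop. 3.4.4 and §3.5 (arXiv:2410.23241 pp. 19–20) (preprint; hypotheses)] -/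
theorem bsdp_gordTwo_five_le_of_twistUnitAt (hF : PrintedFacts)
    (hA : Hsieh2014.thmA_exists_isHsiehLFunction_unrPeriod_anyLevel)
    (hL : LiuZhangZhang2018.thm151_thm153_modularCurve_heegnerVector_additive)
    (hCHσ : castellaHsieh2018_exists_isBranchBDPLFunction_signed)
    (hDVD : thm336_dvd_branch_OPEN) (hAN : thm351_anacong_charLambda_branch_five_le)
    (hprop125 : prop125_characterGrSelmerDual_torsion_muZero_dim)
    (hlift : cor126_residualCharacter_globalLift) (hlocal : cor126_residualCharacter_localSurjective) :
    ∀ (W : WeierstrassCurve ℚ) [W.IsElliptic] [W.IsGloballyMinimal] (p : ℕ) [Fact p.Prime],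
      5 ≤ p → W.analyticRank = 1 → ClassX3 W p → Additive.SubGordTwo W p → Upper.TwistUnitFieldOffSliverAt W p → BSDp W p :=
  KYBranchPerPairOfPT.bsdp_gordTwo_five_le_of_twistUnitAt hF hA hL hCHσ hDVD hAN hprop125 (prop14_residualCharacterSelmer_finite_of_fact hprop125) hlift hlocal
    forall_poitouTate_shaRestricted_tateDual_natural_at_of_isTotallyComplex

/-! ### §3 The WHOLE (G-ord, `e = 2`) half at EVERY odd prime — no Greenberg, no duality binder -/

/-- **The LOWER half `ord_p #Ш(E)_an ≤ ord_p #Ш(E)` PER PAIR on the WHOLE (G-ord, `e = 2`) half of B6 ∩ X3 at EVERY odd prime `p`, NO per-pair hypothesis,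
no Greenberg input, no duality binder** — F42's record with its Milne binder fed by the tree theorem.  INPUT LEDGER: `PrintedFacts` ∪ {Hsieh A, LZZ, Castella–Hsieh
signed} ∪ {[DIV.dvd] PRE; [AN3], [AN-BR₅] PRE; [BR3]; CGLS Thm 2.1.2} ∪ {CGLS Prop 1.2.5 (module clause), Cor 1.2.6 ×2; [RH], [PWL-θ]; Rubin 4.1; Katz II.6.4;
Hida Thm I} — every one refereed print or a Keller–Yin preprint clause.  CONDITIONAL on every displayed hypothesis; closes no item; BSD not advanced
beyond this typed reduction. [claim: KellerYin2024PotOrd, status: under-review]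
[cite: KellerYin2024b, Thm. 3.3.6, Prop. 3.4.4, §3.5, Thm. 3.5.1 and Lemma 2.3.8 (arXiv:2410.23241 pp. 11, 19–20) (preprint; hypotheses)]
[cite: CastellaGrossiLeeSkinner2022, Thms. 1.2.2, 2.1.2, 2.2.2, Props. 1.2.5, 14, Cor. 1.2.6] [cite: KellerYin2024, Thms. 1.2.2, 2.2.2 (arXiv:2402.12781v2)]
[cite: MilneADT2006, I Thm. 4.10 (a)] [cite: JetchevSkinnerWan2017, §7.4.1] [cite: FriedbergHoffstein1995, Thm. B] -/
theorem missingLowerBoundAt_gordTwo (hF : PrintedFacts)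
    (hA : Hsieh2014.thmA_exists_isHsiehLFunction_unrPeriod_anyLevel)
    (hL : LiuZhangZhang2018.thm151_thm153_modularCurve_heegnerVector_additive)
    (hCHσ : castellaHsieh2018_exists_isBranchBDPLFunction_signed)
    (hDVD : thm336_dvd_branch_OPEN)
    (hAN3 : thm351_anacong_branch_three_allTwists) (hBR3 : thm122_charLambda_pair_three) (h212 : thm212_exists_isKatzLFunction)
    (hAN5 : thm351_anacong_charLambda_branch_five_le)
    (hprop125 : prop125_characterGrSelmerDual_torsion_muZero_dim)
    (hlift : cor126_residualCharacter_globalLift) (hlocal : cor126_residualCharacter_localSurjective)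
    (hRH : thm122_rubinHida_residualPair_unrSelmer) (hPWL : prop125_residualPair_unrSelmer_imprimitive)
    (h331 : thm331_rubin_exists_katzMeasure₂_pseudoIso_span_eq)
    (hFE : thmII64_katzMeasure₂_functionalEquation) (hO1 : thmI_mu_katzBranch_reflect_eq_zero) :
    ∀ (W : WeierstrassCurve ℚ) [W.IsElliptic] [W.IsGloballyMinimal] (p : ℕ) [Fact p.Prime],
      W.analyticRank = 1 → p ≠ 2 → ClassX3 W p → Additive.SubGordTwo W p → MissingLowerBoundAt W p :=
  KYBranchPerPairOfPT.missingLowerBoundAt_gordTwo hF hA hL hCHσ hDVD hAN3 hBR3 h212 hAN5 hprop125 (prop14_residualCharacterSelmer_finite_of_fact hprop125) hlift hlocal hRH hPWL h331 hFE hO1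
    forall_poitouTate_shaRestricted_tateDual_natural_at_of_isTotallyComplex

/-- **BOTH halves per pair on the WHOLE (G-ord, `e = 2`) half at EVERY odd prime from the TU datum: `MissingPPartAt W p`, no Greenberg input, no duality binder**
— F42's record with its Milne binder fed by the tree theorem.  CONDITIONAL; closes no item; BSD not advanced beyond this typed reduction.
[claim: KellerYin2024PotOrd, status: under-review] [cite: Miller2011LMS, Def. 1.1] [cite: KellerYin2024b, Thm. 3.3.6, Prop. 3.4.4, §3.5 (arXiv:2410.23241 pp. 19–20) (preprint; hypotheses)] -/
theorem missingPPartAt_gordTwo_of_twistUnitAt (hF : PrintedFacts)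
    (hA : Hsieh2014.thmA_exists_isHsiehLFunction_unrPeriod_anyLevel)
    (hL : LiuZhangZhang2018.thm151_thm153_modularCurve_heegnerVector_additive)
    (hCHσ : castellaHsieh2018_exists_isBranchBDPLFunction_signed)
    (hDVD : thm336_dvd_branch_OPEN)
    (hAN3 : thm351_anacong_branch_three_allTwists) (hBR3 : thm122_charLambda_pair_three) (h212 : thm212_exists_isKatzLFunction)
    (hAN5 : thm351_anacong_charLambda_branch_five_le)
    (hprop125 : prop125_characterGrSelmerDual_torsion_muZero_dim)
    (hlift : cor126_residualCharacter_globalLift) (hlocal : cor126_residualCharacter_localSurjective)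
    (hRH : thm122_rubinHida_residualPair_unrSelmer) (hPWL : prop125_residualPair_unrSelmer_imprimitive)
    (h331 : thm331_rubin_exists_katzMeasure₂_pseudoIso_span_eq)
    (hFE : thmII64_katzMeasure₂_functionalEquation) (hO1 : thmI_mu_katzBranch_reflect_eq_zero) :
    ∀ (W : WeierstrassCurve ℚ) [W.IsElliptic] [W.IsGloballyMinimal] (p : ℕ) [Fact p.Prime],
      W.analyticRank = 1 → p ≠ 2 → ClassX3 W p → Additive.SubGordTwo W p → Upper.TwistUnitFieldOffSliverAt W p → MissingPPartAt W p :=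
  KYBranchPerPairOfPT.missingPPartAt_gordTwo_of_twistUnitAt hF hA hL hCHσ hDVD hAN3 hBR3 h212 hAN5 hprop125 (prop14_residualCharacterSelmer_finite_of_fact hprop125) hlift hlocal hRH hPWL h331 hFE
    hO1 forall_poitouTate_shaRestricted_tateDual_natural_at_of_isTotallyComplex

/-- **Miller's `BSD(E, p)` per pair on the WHOLE (G-ord, `e = 2`) half at EVERY odd prime from the TU datum, no Greenberg input, no duality binder** — F42's record
with its Milne binder fed by the tree theorem.  NOT a proof of BSD for any curve: BSD_p MODULO {published theorems} ∪ {[DIV.dvd], the typed analytic sentences,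
[RH], [PWL-θ]} ∪ {the pair's TU certificate}. [claim: KellerYin2024PotOrd, status: under-review] [cite: Miller2011LMS, §1 and Def. 1.1]
[cite: KellerYin2024b, Thm. 3.3.6, Prop. 3.4.4, §3.5 (arXiv:2410.23241 pp. 19–20) (preprint; hypotheses)] -/
theorem bsdp_gordTwo_of_twistUnitAt (hF : PrintedFacts)
    (hA : Hsieh2014.thmA_exists_isHsiehLFunction_unrPeriod_anyLevel)
    (hL : LiuZhangZhang2018.thm151_thm153_modularCurve_heegnerVector_additive)
    (hCHσ : castellaHsieh2018_exists_isBranchBDPLFunction_signed)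
    (hDVD : thm336_dvd_branch_OPEN)
    (hAN3 : thm351_anacong_branch_three_allTwists) (hBR3 : thm122_charLambda_pair_three) (h212 : thm212_exists_isKatzLFunction)
    (hAN5 : thm351_anacong_charLambda_branch_five_le)
    (hprop125 : prop125_characterGrSelmerDual_torsion_muZero_dim)
    (hlift : cor126_residualCharacter_globalLift) (hlocal : cor126_residualCharacter_localSurjective)
    (hRH : thm122_rubinHida_residualPair_unrSelmer) (hPWL : prop125_residualPair_unrSelmer_imprimitive)
    (h331 : thm331_rubin_exists_katzMeasure₂_pseudoIso_span_eq)
    (hFE : thmII64_katzMeasure₂_functionalEquation) (hO1 : thmI_mu_katzBranch_reflect_eq_zero) :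
    ∀ (W : WeierstrassCurve ℚ) [W.IsElliptic] [W.IsGloballyMinimal] (p : ℕ) [Fact p.Prime],
      W.analyticRank = 1 → p ≠ 2 → ClassX3 W p → Additive.SubGordTwo W p → Upper.TwistUnitFieldOffSliverAt W p → BSDp W p :=
  KYBranchPerPairOfPT.bsdp_gordTwo_of_twistUnitAt hF hA hL hCHσ hDVD hAN3 hBR3 h212 hAN5 hprop125 (prop14_residualCharacterSelmer_finite_of_fact hprop125) hlift hlocal hRH hPWL h331 hFE hO1
    forall_poitouTate_shaRestricted_tateDual_natural_at_of_isTotallyComplex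

end Summit.BirchSwinnertonDyer.BirchSwinnertonDyer.Theorems.SchneiderFreeAdditiveX3.KYBranchPerPairOfTree

end
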